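import Summits.CriticalPhenomena.PercolationContinuityZ3.Theorems.Transplant.PlanarSkeletonFrmFromDefs
import Summits.CriticalPhenomena.PercolationContinuityZ3.Theorems.Transplant.SkelFrmFromBChoiceRootReadRows
import Summits.CriticalPhenomena.PercolationContinuityZ3.Theorems.Transplant.SkelFrmBChoiceRootReadRows
import Summits.CriticalPhenomena.PercolationContinuityZ3.Theorems.Transplant.SkelFrmFromBChoiceRootReadRowsP
import Summits.CriticalPhenomena.PercolationContinuityZ3.Theorems.Transplant.SkelFrmBChoiceRootReadRowsP
import Summits.CriticalPhenomena.PercolationContinuityZ3.Theorems.Transplant.SkelFrmFromBChoiceRootReadDefs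
import Summits.CriticalPhenomena.PercolationContinuityZ3.Theorems.Transplant.SkelFrmBChoiceRootReadDefs
import HarnessLib
import Summits.CriticalPhenomena.PercolationContinuityZ3.Theorems.Transplant.SkelFrmBChoiceRootReadDischarge
/-!
# U-WAVE PORT (RULING D-U, lead g21 2026-08-26; WAVE-U-MANIFEST v3.0 row «SkelFrmBChoiceRootReadDischarge» ↦ «SkelFrmFromBChoiceRootReadDischarge») of the tree module
# `Transplant/SkelFrmBChoiceRootReadDischarge` onto the carrier `PlanarSkeletonFrmFrom` (frames only, cylinders connected from width `ℓ₀` on)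

ORIGINAL TITLE: N2 (frames-only node `SamePDropOfSkeletonFrm₁`, OPEN) — THE FOUR ROOT READING ROWS BY NAME: `KS.RowX1 / RowXA / RowX2 / RowYA`

builds on p205010 (kernel theorem, internal audit signed; external expert review pending) — nothing in this file uses p205010; NOTHING is claimed about the
OPEN node U `SamePDropOfSkeletonFrmFrom₁` (nor U_s / the end state).  Lane `prim-bschramm`, seat `prim-hp-8 gen 53 (U-wave port pen, family P-hp8; tool of record = p3-g26 port_u.py)`; helper file
(`--supports stmt-CriticalPhenomena-4575 --as helper`).  PORT RULES r1–r4 of RULING D-U: declaration order and proof texts are those of the original,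
byte-identical except (i) the carrier token `PlanarSkeletonFrm ↦ PlanarSkeletonFrmFrom` (binders, `namespace`/`end` lines, qualified names of twinned
declarations), (ii) carrier-FREE declarations of the original (φ-level `Skelφ…` blocks and namespace-only arithmetic residents) are NOT re-declared —
this file imports the original and `export`s the twin-free residents (POLICY T / treatment (m1)); residents whose statement mentions a twinned
constant are copied, (iii) every carrier-binding declaration keeps its explicit binder `(Φ : PlanarSkeletonFrmFrom G)` in its own signature (r2).  Docstrings and citations are the original's.  Manifest row idx 193 (level 20; flags verbatim); filed by the hp-8 lineage under RULING M-11 (family P-hp8).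
-/

noncomputable section

namespace Summit.CriticalPhenomena.PercolationContinuityZ3.Theorems.Transplant

namespace PlanarSkeletonFrmFrom

namespace NegB

open Neg

variable (κ : SkelConc.Consts) {V : Type} [DecidableEq V] [Countable V] {G : SimpleGraph V} [G.LocallyFinite] (Φ : PlanarSkeletonFrmFrom G) (t : V) (p : unitInterval)
  (D : Skelφ.StepI.DataNS V) (g f mk : ℕ)

/-- (R-X1) discharges `KS.RowX1` at `(qxQ4, WxQ4)`. [this work] -/
theorem rowX1_Q (κ : SkelConc.Consts) {V : Type} [DecidableEq V] [Countable V] {G : SimpleGraph V} [G.LocallyFinite] (Φ : PlanarSkeletonFrmFrom G) (t : V) (p : unitInterval) (D : Skelφ.StepI.DataNS V) (g : ℕ) (f : ℕ) (mk : ℕ) (hKq : 5 ≤ Neg.Kq κ) (hN : EqNumL κ Φ t p D g f) (hg : gFloorKG κ Φ t p D mk ≤ g) (hg2 : 40 * Neg.K κ * KS0.R'0 κ Φ t p D mk ≤ g) :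
    KS.RowX1 κ Φ t p D mk g f (qxQ4 κ Φ t p D g f) (WxQ4 κ Φ t p D g f) := by
  unfold KS.RowX1 KS.ReadRow; exact rootReadX1_Q κ Φ t p D g f mk hKq hN hg hg2

/-- (R-XA) discharges `KS.RowXA` at `(qxQ4, WxQ4 | cR2vW mk, small3)`. [this work] -/
theorem rowXA_Q (κ : SkelConc.Consts) {V : Type} [DecidableEq V] [Countable V] {G : SimpleGraph V} [G.LocallyFinite] (Φ : PlanarSkeletonFrmFrom G) (t : V) (p : unitInterval) (D : Skelφ.StepI.DataNS V) (g : ℕ) (f : ℕ) (mk : ℕ) (hKq : 5 ≤ Neg.Kq κ) (hN : EqNumL κ Φ t p D g f) (hg : gFloorKG κ Φ t p D mk ≤ g) (hg2 : 40 * Neg.K κ * KS0.R'0 κ Φ t p D mk ≤ g) :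
    KS.RowXA κ Φ t p D mk g f (qxQ4 κ Φ t p D g f) (WxQ4 κ Φ t p D g f) (cR2vW κ Φ t p D g f mk) (BSlot.small3 κ Φ t p D g f) hN hg := by
  unfold KS.RowXA KS.ReadRow; exact rootReadXA_Q κ Φ t p D g f mk hKq hN hg hg2

/-- (R-X2) discharges `KS.RowX2`. [this work] -/
theorem rowX2_Q (κ : SkelConc.Consts) {V : Type} [DecidableEq V] [Countable V] {G : SimpleGraph V} [G.LocallyFinite] (Φ : PlanarSkeletonFrmFrom G) (t : V) (p : unitInterval) (D : Skelφ.StepI.DataNS V) (g : ℕ) (f : ℕ) (mk : ℕ) (hN : EqNumL κ Φ t p D g f) (hg : gFloorKG κ Φ t p D mk ≤ g) (hg2 : 40 * Neg.K κ * KS0.R'0 κ Φ t p D mk ≤ g) :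
    KS.RowX2 κ Φ t p D mk g f := by
  unfold KS.RowX2 KS.ReadRow; exact rootReadX2_Q κ Φ t p D mk g f hN hg hg2

/-- (R-YA) discharges `KS.RowYA` at `(qxYQ4, WxYQ4 | cR2vW mk, small3)`. [this work] -/
theorem rowYA_Q (κ : SkelConc.Consts) {V : Type} [DecidableEq V] [Countable V] {G : SimpleGraph V} [G.LocallyFinite] (Φ : PlanarSkeletonFrmFrom G) (t : V) (p : unitInterval) (D : Skelφ.StepI.DataNS V) (g : ℕ) (f : ℕ) (mk : ℕ) (hKq : 5 ≤ Neg.Kq κ) (hN : EqNumL κ Φ t p D g f) (hg : gFloorKG κ Φ t p D mk ≤ g) (hg2 : 40 * Neg.K κ * KS0.R'0 κ Φ t p D mk ≤ g) :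
    KS.RowYA κ Φ t p D mk g f (qxYQ4 κ Φ t p D g f) (WxYQ4 κ Φ t p D g f) (cR2vW κ Φ t p D g f mk) (BSlot.small3 κ Φ t p D g f) hN hg := by
  unfold KS.RowYA KS.ReadRow; exact rootReadYA_QT κ Φ t p D g f mk hKq hN hg hg2

end NegB

end PlanarSkeletonFrmFrom

end Summit.CriticalPhenomena.PercolationContinuityZ3.Theorems.Transplant

end
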